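import Summits.QuantumFields.BalabanUV.Beta.FP.NestedDressingProjector

/-!
# `BalabanUV.Beta.FP.NestedDressingProjectorLocality` — road «FP» for binder row D1, R-FP-45 (B), row NESTED-DRESS, FILE 2: THE LOCALITY LETTER —
# `σ^{(m)} A x` READS ONLY THE BONDS WITH BOTH ENDPOINTS IN THE `Lc^m`-BLOCK OF `x`, so `(Π^{(m)}_nest A)_κ(x)` reads only the bond `(κ, x)` and the
# two `Lc^m`-blocks met by it (range `0` in `Lc^m`-block units; in-block root); an EXACT read set, no tails

HONEST DEPENDENCY (page 1, mandatory): continuum YM on T⁴ ⇐ BetaPertH ∧ nine spine estimates (0/9 proved); BetaPertH ⇐ (D1) ∧ (D4) ∧ CAP+tail;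
G-an2-4 gates asym, D1 and NE2/3/4.  HONEST FRAMING (cell contract, verbatim): «discharging `BetaPertH` makes Bałaban's UV stability UNCONDITIONAL —
a real constructive-QFT result; it is NOT the continuum limit and NOT the Clay problem.»  THIS MODULE DISCHARGES NOTHING of the wall: [folklore] finite sums
on `ℤ^d` (generic `d`; in-block root `ρ = toSite r`, `r ∈ box d Lc`; `1 ≤ Lc`), over t4-ne9-leaf-06's `CompositeCorrectorLocality.DepOn` calculus.  No `def`,
no `def … : Prop`, nothing cited, 0 sorry; 0∕4 row-D1 binders; NOT SDF, NOT D1, NOT BetaPertH, NOT continuum, NOT Clay.  «not in print; our bookkeeping».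

ABSOLUTE RULE (cell charter, verbatim): «No internally-minted statement may enter as a cited fact. Every hypothesis is either kernel-proved in this package or a
verbatim quotation of a PUBLISHED theorem with page reference. The manuscript(s) under audit are NOT citable for their own disputed steps — they are the thing
under adjudication; programme-internal (2001/route/tribunal) claims are never citable.»

WHY (owner memo `N2B-DESIGN.md` v2 §9 (9e) (B): «letters: idempotent, kills `dzΘ_{Lc^m}`, `|_{V₁} = Π̂₁`, LOCALITY within `Lc^m`-blocks»; an2 R-D1-g31-3 l.33138:
«kit constants come from explicit axial-tree entry formulas; `(τ̃ dz|_Θ)⁻¹` has none ⇒ Combes–Thomas-type input?»).  FILE 1 (`NestedDressingProjector`) solved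
`(τ̃ dz|_Θ)⁻¹τ̃` in CLOSED FORM: `σ^{(m)} A x = Σ_{k<m} σ₁ (𝒬̄^k A) (blk (Lc^k) x)` (`symNestGaugeAt_eq_sum`).  Each summand is an explicit finite sum: the
level-`k` one-step functional `σ₁ = symBmGaugeAt` at the coarse point `blk (Lc^k) x` reads coarse bonds inside ONE `Lc`-block (in-block root: the symmetrised
axial contours never leave the block), and the `k`-fold averaged bond `(𝒬̄^k A)(κ′, z′)` reads fine bonds inside the `Lc^k`-block PAIR of `z′`; nesting the two
(`blk_pow_succ_eq_of_inPair`) puts every fine bond read inside the `Lc^(k+1)`-block of `x`, hence inside its `Lc^m`-block.  So the matrix of `Π^{(m)}_nest` has an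
EXACT window — no decay estimate is needed or used (answer to an2's question for this letter; the BOUND on the entries is the next file).

CONTENTS ([folklore]): §1 `depOn_symTreeGaugeAt` (the SYMMETRISED rooted tree integral at `x` reads only `InBlockBond N (blk N x)` — an2's `symTreeGaugeAt_eq_sum`
over the axis orders + the comb case `depOn_treeGaugeAt` transported by `P1 σ`), `depOn_symGaugeAt`, `depOn_blockMeanAt` (a block mean of block-local readings is
block-local), **`depOn_symBmGaugeAt`**; §2 `depOn_contourSum` ∕ `depOn_qbar` (the straight average at the coarse bond `(κ, Z)` reads `InPairBond N κ Z`),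
**`depOn_qbar_iterate`** (`𝒬̄^k` reads `InPairBond (Lc^k) κ Z`); §3 `inBlockBond_pow_subset` (nested blocks), **`depOn_symNestGaugeAt`**
(`DepOn (InBlockBond (Lc^m) (blk (Lc^m) x)) (σ^{(m)} · x)`), **`depOn_symAxProjNestAt`** (`(Π^{(m)} A)_κ(x)` reads `{(κ,x)} ∪` the two `Lc^m`-blocks of `x`, `x + e_κ`),
`symAxProjNestAt_apply_eq_of_forall` (the read-set statement unfolded).
Provenance: road FP swarm LEAF PROVER `b2b-balaban-beta-d1-formalise-leaf-06` gen 14, 2026-08-21, row NESTED-DRESS (owner assignment l.33213; an2 first refusal passed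
l.33138).  Names PROVISIONAL.
-/

namespace Summit.QuantumFields.BalabanUV.Beta.FP.NestedDressingProjectorLocality

noncomputable section

open Finset
open scoped BigOperators Nat
open Literature.MathematicalPhysics.QuantumFieldTheory.Balaban1983to89.Beta
open AffineAveraging (Form0 Form1 Site unitVec unitVec_apply dz box toSite blockSum contourSum)
open AveragingContours (grad blk blk_block)
open AveragingContoursRooted (treeGaugeAt)
open Summit.QuantumFields.BalabanUV.Beta.KernelPermutation (psite psite_apply psite_symm_apply psite_add psite_symm_apply_eq)
open Summit.QuantumFields.BalabanUV.Beta.ResolventPermutation (P1 P1_apply psite_mem_box psite_unitVec)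
open Summit.QuantumFields.BalabanUV.Beta.AxialProjectorBlockMean (blockMeanAt)
open Summit.QuantumFields.BalabanUV.Beta.SymmetrisedAxialPotential (symTreeGaugeAt symTreeGaugeAt_eq_sum blk_psite_symm)
open Summit.QuantumFields.BalabanUV.Beta.SymmetrisedAxialGaugeBlockMean (symGaugeAt symBmGaugeAt symAxProjBmAt)
open Summit.QuantumFields.BalabanUV.Beta.CompositeCorrectorLocality
  (DepOn depOn_const depOn_eval depOn_sum InBlockBond InPair InPairBond mem_inBlockBond inPair_of_blk_eq inPair_of_blk_eq_add inPair_seg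
    depOn_treeGaugeAt blk_one blk_pow_succ' inPair_pow_succ blk_pow_succ_eq_of_inPair)
open Summit.QuantumFields.BalabanUV.Beta.FP.NestedDressingProjector (qbar liftBlk symNestGaugeAt symAxProjNestAt symNestGaugeAt_eq_sum blk_blk')

variable {d : ℕ}

/-! ## §1 One level: the symmetrised one-step functional reads one block -/

/-- [folklore] **THE SYMMETRISED ROOTED TREE INTEGRAL AT `x` READS ONLY BONDS WITH BOTH ENDPOINTS IN THE `N`-BLOCK OF `x`** (in-block root offset `r`):
sum over the axis orders `σ` of the comb case (`depOn_treeGaugeAt` at the pulled-back root `σ⁻¹•r ∈ box` and point `σ⁻¹•x`), each transported by `P1 σ`,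
which maps a bond of the block of `σ⁻¹•x` to a bond of the block of `x`. -/
theorem depOn_symTreeGaugeAt {N : ℕ} (hN : 1 ≤ N) {r : Fin d → ℕ} (hr : r ∈ box d N) (x : Site d) :
    DepOn (InBlockBond N (blk N x)) fun A => symTreeGaugeAt (toSite r) A N x := by
  have e : (fun A : Form1 d ℝ => symTreeGaugeAt (toSite r) A N x)
      = fun A => ∑ σ : Equiv.Perm (Fin d), treeGaugeAt (toSite ((psite σ).symm r)) (P1 σ A) N ((psite σ).symm x) := by
    funext A; rw [symTreeGaugeAt_eq_sum]; rfl
  rw [e]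
  refine depOn_sum _ fun σ _ => ?_
  have hrσ : (psite σ).symm r ∈ box d N := by rw [psite_symm_apply_eq]; exact psite_mem_box σ⁻¹ hr
  refine (depOn_treeGaugeAt hN hrσ ((psite σ).symm x)).comp (PT := fun q => {(σ q.1, psite σ q.2)})
    (fun q _ => ?_) (fun q hq => ?_)
  · exact depOn_eval (σ q.1) (psite σ q.2)
  · intro p hp
    rw [Set.mem_singleton_iff] at hp
    subst hp
    obtain ⟨h1, h2⟩ := (mem_inBlockBond.mp hq)
    rw [blk_psite_symm] at h1 h2
    refine mem_inBlockBond.mpr ⟨?_, ?_⟩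
    · have h := congrArg (psite σ) h1
      rwa [Equiv.apply_symm_apply, show psite σ (blk N q.2) = blk N (psite σ q.2) from rfl] at h
    · have h := congrArg (psite σ) h2
      rwa [Equiv.apply_symm_apply, show psite σ (blk N (q.2 + unitVec q.1)) = blk N (psite σ (q.2 + unitVec q.1)) from rfl, psite_add,
        psite_unitVec] at h

/-- [folklore] … hence so does the normalised gauge `symGaugeAt = (d!)⁻¹·symTreeGaugeAt`. -/
theorem depOn_symGaugeAt {N : ℕ} (hN : 1 ≤ N) {r : Fin d → ℕ} (hr : r ∈ box d N) (x : Site d) :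
    DepOn (InBlockBond N (blk N x)) fun A => symGaugeAt (toSite r) A N x :=
  (depOn_symTreeGaugeAt hN hr x).mul_left _

/-- [folklore] **A BLOCK MEAN OF BLOCK-LOCAL READINGS IS BLOCK-LOCAL**: if `A ↦ g A w` reads only the bonds of the `N`-block of `w`, for every `w`, then
`A ↦ blockMeanAt N (g A) x` reads only the bonds of the `N`-block of `x`. -/
theorem depOn_blockMeanAt {N : ℕ} {g : Form1 d ℝ → Form0 d ℝ} (hg : ∀ w : Site d, DepOn (InBlockBond N (blk N w)) fun A => g A w) (x : Site d) :
    DepOn (InBlockBond N (blk N x)) fun A => blockMeanAt N (g A) x := by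
  refine ⟨fun A B hAB => ?_⟩
  show blockSum N (g A) (blk N x) / ((N : ℝ) ^ d) = blockSum N (g B) (blk N x) / ((N : ℝ) ^ d)
  congr 1
  refine Finset.sum_congr rfl fun b hb => (hg _).eq fun κ y hy => hAB κ y ?_
  rwa [blk_block (blk N x) hb] at hy

/-- [folklore] **THE LITERAL's ONE-STEP FUNCTIONAL `σ₁ = symBmGaugeAt` AT `x` READS ONLY THE `N`-BLOCK OF `x`** (in-block root). -/
theorem depOn_symBmGaugeAt {N : ℕ} (hN : 1 ≤ N) {r : Fin d → ℕ} (hr : r ∈ box d N) (x : Site d) :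
    DepOn (InBlockBond N (blk N x)) fun A => symBmGaugeAt (toSite r) A N x :=
  (depOn_symGaugeAt hN hr x).sub (depOn_blockMeanAt (fun w => depOn_symGaugeAt hN hr w) x)

/-! ## §2 The straight averaging reads one block pair; its iterates read nested block pairs -/

/-- [folklore] **THE STRAIGHT BLOCK-CONTOUR SUM AT THE COARSE BOND `(κ, Z)` READS ONLY BONDS WITH BOTH ENDPOINTS IN THE `N`-BLOCK PAIR `{Z, Z + e_κ}`.** -/
theorem depOn_contourSum {N : ℕ} (hN : 1 ≤ N) (κ : Fin d) (Z : Site d) :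
    DepOn (InPairBond N κ Z) fun A => contourSum N A κ Z := by
  refine depOn_sum _ fun b hb => depOn_sum _ fun s hs => (depOn_eval κ _).mono ?_
  intro p hp
  rw [Set.mem_singleton_iff] at hp
  subst hp
  have hs' : s < N := Finset.mem_range.mp hs
  refine ⟨inPair_seg hN Z hb hs'.le, ?_⟩
  have e : (N : ℤ) • Z + toSite b + (s : ℤ) • unitVec κ + unitVec κ = (N : ℤ) • Z + toSite b + ((s + 1 : ℕ) : ℤ) • unitVec κ := by
    rw [Nat.cast_succ, add_smul, one_smul, add_assoc]
  show (N : ℤ) • Z + toSite b + (s : ℤ) • unitVec κ + unitVec κ ∈ InPair N κ Z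
  rw [e]
  exact inPair_seg hN Z hb (by omega)

/-- [folklore] … and so does the mean-normalised `𝒬̄_N`. -/
theorem depOn_qbar {N : ℕ} (hN : 1 ≤ N) (κ : Fin d) (Z : Site d) : DepOn (InPairBond N κ Z) fun A => qbar N A κ Z :=
  (depOn_contourSum hN κ Z).mul_left _

/-- [folklore] The bond pair of blocking `1` at `(κ, Z)` contains the bond `(κ, Z)` itself. -/
theorem mem_inPairBond_one (κ : Fin d) (Z : Site d) : (κ, Z) ∈ InPairBond 1 κ Z :=
  ⟨inPair_of_blk_eq (blk_one Z), inPair_of_blk_eq_add (blk_one _)⟩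

/-- [folklore] **THE `k`-FOLD AVERAGED BOND `(𝒬̄^k A)(κ, Z)` READS ONLY FINE BONDS WITH BOTH ENDPOINTS IN THE `Lc^k`-BLOCK PAIR `{Z, Z + e_κ}`**
(induction: one more outer averaging reads coarse bonds of the `Lc`-pair, each reading an `Lc^k`-pair — `inPair_pow_succ`). -/
theorem depOn_qbar_iterate {Lc : ℕ} (hLc : 1 ≤ Lc) : ∀ (k : ℕ) (κ : Fin d) (Z : Site d),
    DepOn (InPairBond (Lc ^ k) κ Z) fun A => (qbar Lc)^[k] A κ Z
  | 0, κ, Z => by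
      simp only [Function.iterate_zero, id, pow_zero]
      exact (depOn_eval κ Z).mono fun p hp => by rw [Set.mem_singleton_iff] at hp; subst hp; exact mem_inPairBond_one κ Z
  | k + 1, κ, Z => by
      simp only [Function.iterate_succ_apply']
      refine (depOn_qbar hLc κ Z).comp (PT := fun q => InPairBond (Lc ^ k) q.1 q.2) (fun q _ => depOn_qbar_iterate hLc k q.1 q.2)
        (fun q hq p hp => ?_)
      exact ⟨inPair_pow_succ hLc hp.1 hq.1 hq.2, inPair_pow_succ hLc hp.2 hq.1 hq.2⟩

/-! ## §3 All levels: the nested functional reads one `Lc^m`-block; the projector reads the bond and the two blocks it meets -/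

/-- [folklore] Nested blocks: a bond with both endpoints in an `Lc^k`-block has both endpoints in the `Lc^(k+j)`-block containing it. -/
theorem inBlockBond_pow_subset (Lc k j : ℕ) (x : Site d) :
    InBlockBond (Lc ^ k) (blk (Lc ^ k) x) ⊆ InBlockBond (Lc ^ (k + j)) (blk (Lc ^ (k + j)) x) := by
  intro p hp
  obtain ⟨h1, h2⟩ := mem_inBlockBond.mp hp
  refine mem_inBlockBond.mpr ⟨?_, ?_⟩
  · rw [pow_add, ← blk_blk', ← blk_blk', h1]
  · rw [pow_add, ← blk_blk', ← blk_blk', h2]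

/-- [folklore] **THE NESTED FUNCTIONAL `σ^{(m)} A x` READS ONLY THE BONDS WITH BOTH ENDPOINTS IN THE `Lc^m`-BLOCK OF `x`** (in-block root `r ∈ box d Lc`,
`1 ≤ Lc`; by the closed form `symNestGaugeAt_eq_sum`: the level-`k` summand reads, through `𝒬̄^k`, the `Lc^k`-block pairs of the coarse bonds inside the
`Lc`-block of `blk (Lc^k) x`, all inside the `Lc^(k+1)`-block of `x` — `blk_pow_succ_eq_of_inPair`). -/
theorem depOn_symNestGaugeAt {Lc : ℕ} (hLc : 1 ≤ Lc) {r : Fin d → ℕ} (hr : r ∈ box d Lc) (m : ℕ) (x : Site d) :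
    DepOn (InBlockBond (Lc ^ m) (blk (Lc ^ m) x)) fun A => symNestGaugeAt (toSite r) Lc m A x := by
  have e : (fun A : Form1 d ℝ => symNestGaugeAt (toSite r) Lc m A x)
      = fun A => ∑ k ∈ Finset.range m, symBmGaugeAt (toSite r) ((qbar Lc)^[k] A) Lc (blk (Lc ^ k) x) := by
    funext A; exact symNestGaugeAt_eq_sum (toSite r) Lc m A x
  rw [e]
  refine depOn_sum _ fun k hk => ?_
  have hkm : k + 1 + (m - (k + 1)) = m := by have := Finset.mem_range.mp hk; omega
  have hstep : DepOn (InBlockBond (Lc ^ (k + 1)) (blk (Lc ^ (k + 1)) x))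
      fun A => symBmGaugeAt (toSite r) ((qbar Lc)^[k] A) Lc (blk (Lc ^ k) x) := by
    refine (depOn_symBmGaugeAt hLc hr (blk (Lc ^ k) x)).comp (PT := fun q => InPairBond (Lc ^ k) q.1 q.2)
      (fun q _ => depOn_qbar_iterate hLc k q.1 q.2) (fun q hq p hp => ?_)
    obtain ⟨h1, h2⟩ := mem_inBlockBond.mp hq
    rw [← blk_pow_succ' hLc] at h1 h2
    exact mem_inBlockBond.mpr ⟨blk_pow_succ_eq_of_inPair hLc hp.1 h1 h2, blk_pow_succ_eq_of_inPair hLc hp.2 h1 h2⟩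
  have h := hstep.mono (inBlockBond_pow_subset Lc (k + 1) (m - (k + 1)) x)
  rwa [hkm] at h

/-- [folklore] **LOCALITY OF THE NESTED PROJECTOR**: `(Π^{(m)}_nest A)_κ(x)` reads only the bond `(κ, x)` and the bonds with both endpoints in the `Lc^m`-block of
`x` or in the `Lc^m`-block of `x + e_κ` — range `0` in `Lc^m`-block units (the fourth letter of the row). -/
theorem depOn_symAxProjNestAt {Lc : ℕ} (hLc : 1 ≤ Lc) {r : Fin d → ℕ} (hr : r ∈ box d Lc) (m : ℕ) (κ : Fin d) (x : Site d) :
    DepOn ({(κ, x)} ∪ (InBlockBond (Lc ^ m) (blk (Lc ^ m) x) ∪ InBlockBond (Lc ^ m) (blk (Lc ^ m) (x + unitVec κ))))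
      fun A => symAxProjNestAt (toSite r) Lc m A κ x := by
  have e : (fun A : Form1 d ℝ => symAxProjNestAt (toSite r) Lc m A κ x)
      = fun A => A κ x - (symNestGaugeAt (toSite r) Lc m A (x + unitVec κ) - symNestGaugeAt (toSite r) Lc m A x) := by
    funext A; rfl
  rw [e]
  exact ((depOn_eval κ x).mono Set.subset_union_left).sub
    (((depOn_symNestGaugeAt hLc hr m (x + unitVec κ)).mono (Set.subset_union_right.trans Set.subset_union_right)).sub
      ((depOn_symNestGaugeAt hLc hr m x).mono (Set.subset_union_left.trans Set.subset_union_right)))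

/-- [folklore] The read-set statement, unfolded: two fields that agree on the bond `(κ, x)` and on every bond with both endpoints in the `Lc^m`-block of `x` or of
`x + e_κ` have the same `(Π^{(m)}_nest ·)_κ(x)`. -/
theorem symAxProjNestAt_apply_eq_of_forall {Lc : ℕ} (hLc : 1 ≤ Lc) {r : Fin d → ℕ} (hr : r ∈ box d Lc) (m : ℕ) (κ : Fin d) (x : Site d)
    {A B : Form1 d ℝ} (h0 : A κ x = B κ x)
    (h1 : ∀ κ' y, blk (Lc ^ m) y = blk (Lc ^ m) x → blk (Lc ^ m) (y + unitVec κ') = blk (Lc ^ m) x → A κ' y = B κ' y)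
    (h2 : ∀ κ' y, blk (Lc ^ m) y = blk (Lc ^ m) (x + unitVec κ) → blk (Lc ^ m) (y + unitVec κ') = blk (Lc ^ m) (x + unitVec κ) → A κ' y = B κ' y) :
    symAxProjNestAt (toSite r) Lc m A κ x = symAxProjNestAt (toSite r) Lc m B κ x := by
  refine (depOn_symAxProjNestAt hLc hr m κ x).eq fun κ' y hy => ?_
  rcases hy with hy | hy | hy
  · rw [Set.mem_singleton_iff, Prod.mk.injEq] at hy
    rw [hy.1, hy.2]; exact h0
  · exact h1 κ' y hy.1 hy.2
  · exact h2 κ' y hy.1 hy.2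

end

end Summit.QuantumFields.BalabanUV.Beta.FP.NestedDressingProjectorLocality
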